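import Mathlib
import Summits.ResolutionOfSingularities.ResolutionOfSingularities.Theorems.WildQuotientsKiralyLutkebohmertLemmas
import HarnessLib

/-!
# Király–Lütkebohmert (ANT 7 (2013)), §3 (∗): a free module-finite `B` over the fixed ring of an
# automorphism of prime order `p` is free OF RANK EXACTLY `p`

Route `ResolutionOfSingularities/WildQuotients`; helper toward the depth-0 / kill-criterion dictionary
of the crux `CyclicQuotientFourfolds` (stmt-ResolutionOfSingularities-17941, research stub
`stub_reachLowerInFX`; memo `KL-CONJ9-STATUS.md`, remaining item 1 (i)). F. Király, W. Lütkebohmert,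
*Group actions of prime order on local normal rings*, Algebra & Number Theory 7 (2013) 63–74, §3:
«Since `A` is regular, the ring `B` is a free `A`-module of rank `p` … So `B/B𝔪_Aⁿ` is a free
`A/𝔪_Aⁿ`-module of rank `p` for any `n ∈ ℕ`. (∗)».

* `kl_nonempty_basis_fin_of_free` — for a domain `B`, `σ` of prime order `p` (`σ ≠ 1`, `σ^p = 1`)
  and `B` free and module-finite over `A = B^σ`: `B` has an `A`-basis indexed by `Fin p`. Proof: an
  `A`-basis of `B` is a `K`-basis of `L = Frac B` over the fixed field `K = L^σ` — linearly
  independent (invariant common denominators `N(b') = ∏_k σ^k b'`) AND spanning (`b/b' = b·m / N(b')`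
  with `N(b') = b'·m` invariant) — and `[L : K] = p` (Artin). The tree's
  `kl_exists_fin_span_eq_top_of_free` (`…ConjectureNineTwo.lean`) had only the inequality `rank ≤ p`.
* `kl_finrank_fixed_eq` — hence `finrank_A B = p`. [cite: KiralyLutkebohmert2013, §3 (∗), p. 70]

[OURS · crux stmt-ResolutionOfSingularities-17941 · helper (def-free), printed statement (∗) of
KiralyLutkebohmert2013 §3; counted 0; AI-level work, weaker than expert review.]
-/

-- single-problem summit: the doubled namespace component `ResolutionOfSingularities` is forced
set_option linter.dupNamespace false

open IsLocalRing

namespace Summit.ResolutionOfSingularities.ResolutionOfSingularities.Theorems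

/-- **«`B` is a free `A`-module of rank `p`» (Király–Lütkebohmert §3 (∗))**: for a domain `B`, a ring
automorphism `σ` of prime order `p` and `B` free and module-finite over the fixed ring `A = B^σ`,
there is an `A`-basis of `B` indexed by `Fin p`. [cite: KiralyLutkebohmert2013, §3 (∗), p. 70] -/
theorem kl_nonempty_basis_fin_of_free {B : Type*} [CommRing B] [IsDomain B] {p : ℕ}
    (hp : p.Prime) (σ : B ≃+* B) (hσ : σ ^ p = 1) (hσ1 : σ ≠ 1)
    [Module.Free ((σ : B →+* B).eqLocus (RingHom.id B)) B]
    [Module.Finite ((σ : B →+* B).eqLocus (RingHom.id B)) B] :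
    Nonempty (Module.Basis (Fin p) ((σ : B →+* B).eqLocus (RingHom.id B)) B) := by
  classical
  haveI : Fact p.Prime := ⟨hp⟩
  set A : Subring B := (σ : B →+* B).eqLocus (RingHom.id B) with hA_def
  have memA : ∀ b : B, b ∈ A ↔ σ b = b := fun b => Iff.rfl
  -- adapted from Theorems/WildQuotientsKiralyLutkebohmertConjectureNineTwo.lean
  -- (`kl_exists_fin_span_eq_top_of_free`), with the spanning half added
  -- the fraction field and the induced automorphism (as in `kl_free`)
  let L := FractionRing B
  let ι : B →+* L := algebraMap B L
  have hι : Function.Injective ι := IsFractionRing.injective B L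
  let σL : L ≃+* L := IsFractionRing.ringEquivOfRingEquivHom B L σ
  have hσLpow : ∀ (k : ℕ) (b : B), (σL ^ k) (ι b) = ι ((σ ^ k) b) := by
    intro k b
    have : σL ^ k = IsFractionRing.ringEquivOfRingEquivHom B L (σ ^ k) := (map_pow _ σ k).symm
    rw [this, IsFractionRing.ringEquivOfRingEquivHom_apply,
      IsFractionRing.ringEquivOfRingEquiv_algebraMap]
  have hσL : ∀ b, σL (ι b) = ι (σ b) := fun b => by simpa using hσLpow 1 b
  have hσLp : σL ^ p = 1 := by
    rw [show σL = IsFractionRing.ringEquivOfRingEquivHom B L σ from rfl, ← map_pow, hσ, map_one]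
  have hσL1 : σL ≠ 1 := by
    intro h
    apply hσ1
    ext b
    apply hι
    rw [← hσL, h]
    rfl
  -- the cyclic group generated by `σL` and its fixed field `K`
  let G : Subgroup (L ≃+* L) := Subgroup.zpowers σL
  have hfin : IsOfFinOrder σL := isOfFinOrder_iff_pow_eq_one.mpr ⟨p, hp.pos, hσLp⟩
  haveI : Fintype G := Fintype.ofEquiv _ (finEquivZPowers hfin)
  have hcard : Fintype.card G = p := by
    rw [Fintype.card_eq_nat_card, Nat.card_zpowers, orderOf_eq_prime hσLp hσL1]
  haveI : FaithfulSMul G L := ⟨fun {g₁ g₂} h => Subtype.ext (RingEquiv.ext h)⟩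
  let K : Subfield L := FixedPoints.subfield G L
  have memK : ∀ l : L, l ∈ K ↔ σL l = l := by
    intro l
    change (∀ g : G, g • l = l) ↔ _
    constructor
    · intro h
      exact h ⟨σL, Subgroup.mem_zpowers σL⟩
    · intro h g
      change (g : L ≃+* L) • l = l
      exact smul_eq_self_of_mem_zpowers g.2 h
  have hfinrank : Module.finrank K L = p := by rw [FixedPoints.finrank_eq_card, hcard]
  -- `σ`-invariant numerators and denominators for elements of `K`: the norm-like denominator
  -- `N b = ∏_{k<p} σ^k b` is invariant, non-zero for `b ≠ 0` and divisible by `b`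
  let N : B → B := fun b => ∏ k ∈ Finset.range p, (σ ^ k) b
  have hNfix : ∀ b, σ (N b) = N b := by
    intro b
    obtain ⟨m, hm⟩ : ∃ m, p = m + 1 := ⟨p - 1, (Nat.sub_add_cancel hp.pos).symm⟩
    simp only [N, map_prod]
    have e1 : ∀ k, σ ((σ ^ k) b) = (σ ^ (k + 1)) b := fun k => by rw [kl_pow_succ_apply]
    simp_rw [e1, hm]
    rw [Finset.prod_range_succ, Finset.prod_range_succ' (fun k => (σ ^ k) b), ← hm, hσ, pow_zero]
  have hN0 : ∀ b, b ≠ 0 → N b ≠ 0 := by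
    intro b hb
    simp only [N]
    rw [Finset.prod_ne_zero_iff]
    intro k _
    exact (map_ne_zero_iff _ (σ ^ k).injective).mpr hb
  have hNdvd : ∀ b, b ∣ N b := by
    intro b
    have h := Finset.dvd_prod_of_mem (fun k => (σ ^ k) b) (Finset.mem_range.mpr hp.pos)
    simp only [pow_zero, RingAut.one_apply] at h
    exact h
  have hK : ∀ k : K, ∃ c d : B, σ c = c ∧ σ d = d ∧ d ≠ 0 ∧ (k : L) * ι d = ι c := by
    intro k
    obtain ⟨b, b', hb', hk⟩ := IsFractionRing.div_surjective (A := B) (k : L)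
    have hb'0 : b' ≠ 0 := nonZeroDivisors.ne_zero hb'
    obtain ⟨m, hm⟩ := hNdvd b'
    have e1 : (k : L) * ι (N b') = ι (b * m) := by
      have : ι b' ≠ 0 := (map_ne_zero_iff ι hι).mpr hb'0
      rw [← hk, hm, map_mul, map_mul, ← mul_assoc, div_mul_cancel₀ _ this]
    refine ⟨b * m, N b', ?_, hNfix b', hN0 b' hb'0, e1⟩
    have hkK : σL (k : L) = k := (memK _).mp k.2
    have e2 : σL ((k : L) * ι (N b')) = (k : L) * ι (N b') := by
      rw [map_mul, hkK, hσL, hNfix]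
    rw [e1, hσL] at e2
    exact hι e2
  have hsmul : ∀ (k : K) (x : L), k • x = (k : L) * x := fun _ _ => rfl
  -- an `A`-basis of `B` is `K`-linearly independent in `L`
  let I := Module.Free.ChooseBasisIndex A B
  let bs : Module.Basis I A B := Module.Free.chooseBasis A B
  have hli : LinearIndependent K fun i : I => ι (bs i) := by
    rw [Fintype.linearIndependent_iff]
    intro g hg
    choose c d hc hd hd0 hcd using fun i => hK (g i)
    -- common invariant denominator
    let D : B := ∏ i, d i
    have hDfix : σ D = D := by simp only [D, map_prod]; exact Finset.prod_congr rfl fun i _ => hd i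
    have hgD : ∀ i, (g i : L) * ι D = ι (c i * ∏ j ∈ Finset.univ.erase i, d j) := by
      intro i
      simp only [D]
      rw [← Finset.mul_prod_erase Finset.univ d (Finset.mem_univ i), map_mul, ← mul_assoc, hcd i,
        map_mul]
    let a : I → A := fun i => ⟨c i * ∏ j ∈ Finset.univ.erase i, d j, by
      rw [memA, map_mul, hc i, map_prod]
      congr 1
      exact Finset.prod_congr rfl fun j _ => hd j⟩
    have hg' : ∑ i, (g i : L) * ι (bs i) = 0 := by simpa only [hsmul] using hg
    have hsum : ∑ i, a i • bs i = 0 := by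
      apply hι
      rw [map_sum, map_zero]
      calc ∑ i, ι (a i • bs i) = ∑ i, ((g i : L) * ι (bs i)) * ι D := by
            refine Finset.sum_congr rfl fun i _ => ?_
            have hai : ι (a i : B) = (g i : L) * ι D := (hgD i).symm
            rw [Subring.smul_def, smul_eq_mul, map_mul, hai]
            ring
        _ = (∑ i, (g i : L) * ι (bs i)) * ι D := by rw [Finset.sum_mul]
        _ = 0 := by rw [hg', zero_mul]
    intro i
    have hai : a i = 0 := Fintype.linearIndependent_iff.mp bs.linearIndependent a hsum i
    have hci : c i = 0 := by
      have h1 : (c i) * ∏ j ∈ Finset.univ.erase i, d j = 0 := congrArg Subtype.val hai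
      rcases mul_eq_zero.mp h1 with h | h
      · exact h
      · exact absurd h (Finset.prod_ne_zero_iff.mpr fun j _ => hd0 j)
    have : (g i : L) * ι (d i) = 0 := by rw [hcd i, hci, map_zero]
    rcases mul_eq_zero.mp this with h | h
    · exact Subtype.ext h
    · exact absurd h ((map_ne_zero_iff ι hι).mpr (hd0 i))
  -- spanning: `L = K · ι(B)`
  have hsp : ⊤ ≤ Submodule.span K (Set.range fun i : I => ι (bs i)) := by
    intro l _
    obtain ⟨b, b', hb', hl⟩ := IsFractionRing.div_surjective (A := B) l
    have hb'0 : b' ≠ 0 := nonZeroDivisors.ne_zero hb'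
    obtain ⟨m, hm⟩ := hNdvd b'
    have hN : ι (N b') ≠ 0 := (map_ne_zero_iff ι hι).mpr (hN0 b' hb'0)
    -- the invariant scalar `1 / N(b')`
    let k₀ : K := ⟨(ι (N b'))⁻¹, (memK _).mpr (by rw [map_inv₀, hσL, hNfix])⟩
    have hl' : l = k₀ • ι (b * m) := by
      rw [hsmul, ← hl]
      have h1 : algebraMap B L b' ≠ 0 := (map_ne_zero_iff ι hι).mpr hb'0
      have h2 : algebraMap B L m ≠ 0 := by
        intro h0
        apply hN
        show algebraMap B L (N b') = 0
        rw [hm, map_mul, h0, mul_zero]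
      show algebraMap B L b / algebraMap B L b' =
        (algebraMap B L (N b'))⁻¹ * algebraMap B L (b * m)
      rw [hm, map_mul, map_mul, mul_inv, eq_comm]
      calc (algebraMap B L b')⁻¹ * (algebraMap B L m)⁻¹ * (algebraMap B L b * algebraMap B L m)
          = algebraMap B L b * (algebraMap B L b')⁻¹ * ((algebraMap B L m)⁻¹ * algebraMap B L m) := by
            ring
        _ = algebraMap B L b / algebraMap B L b' := by
            rw [inv_mul_cancel₀ h2, mul_one, div_eq_mul_inv]
    rw [hl']
    refine Submodule.smul_mem _ _ ?_
    -- `ι (b m)` is a `K`-combination of the `ι (bs i)`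
    rw [← bs.sum_repr (b * m), map_sum]
    refine Submodule.sum_mem _ fun i _ => ?_
    have e : ι ((bs.repr (b * m) i) • bs i) =
        (⟨ι ((bs.repr (b * m) i : B)), (memK _).mpr (by rw [hσL, (memA _).mp (bs.repr (b * m) i).2])⟩ : K) •
          ι (bs i) := by
      rw [Subring.smul_def, smul_eq_mul, map_mul, hsmul]
    rw [e]
    exact Submodule.smul_mem _ _ (Submodule.subset_span ⟨i, rfl⟩)
  let bK : Module.Basis I K L := Module.Basis.mk hli hsp
  have hcardI : Fintype.card I = p := by
    rw [← hfinrank, Module.finrank_eq_card_basis bK]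
  exact ⟨bs.reindex (Fintype.equivFinOfCardEq hcardI)⟩

/-- **`finrank_{B^σ} B = p`** under the same hypotheses. [cite: KiralyLutkebohmert2013, §3 (∗), p. 70] -/
theorem kl_finrank_fixed_eq {B : Type*} [CommRing B] [IsDomain B] {p : ℕ}
    (hp : p.Prime) (σ : B ≃+* B) (hσ : σ ^ p = 1) (hσ1 : σ ≠ 1)
    [Module.Free ((σ : B →+* B).eqLocus (RingHom.id B)) B]
    [Module.Finite ((σ : B →+* B).eqLocus (RingHom.id B)) B] :
    Module.finrank ((σ : B →+* B).eqLocus (RingHom.id B)) B = p := by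
  obtain ⟨bs⟩ := kl_nonempty_basis_fin_of_free hp σ hσ hσ1
  rw [Module.finrank_eq_card_basis bs, Fintype.card_fin]

end Summit.ResolutionOfSingularities.ResolutionOfSingularities.Theorems
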